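import Summits.CriticalPhenomena.CardyFormulaZ2.Theorems.CardyComplexConeEdgePrecompactUFRSArmDominationResiduals

/-!
# The junction event and the J-form residual configurations of the UFRS arm domination
(line `qkz-strip-boundary-arm` of crux `CardyComplexCone.EdgePrecompact`, stmt-CriticalPhenomena-11387;
item (H₁) `ufrs_armDomination2` of the corrected road map for the uniform forward response
stability "UFRS", vocabulary of `…UFRSEvents.lean`, residual propositions of
`…UFRSArmDominationResiduals.lean`)

Definitions only. The residual configuration `ufrs_initialExitNearCase_cert` of the arm
domination (INITIAL branch, corner-disjoint start strands, the exit of the translate within `ρ/4`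
of the start vertex) turned out not to be certified by `ufrsCert E w z (4η) (ρ/2)` from the named
strands of the failure analysis: the MARKED branch asks for a third strand-crossing which is not
among them. What the named strands DO give (`ufrs_initialExitNear_junction`,
`…UFRSInitialExitNearStrands.lean`) is, at a collar point `z ∈ E.Ω` with a marked edge within
`4η`, a dyadic radius `R' = ρ/4/2^(k+1) ≥ 32 · 4η` with two strand-crossings of `A(z; 4η, R')`
and two strand-crossings of `A(z; 4R', ρ/4)` — a TWO-SCALE JUNCTION configuration, whose
probability on rectangles is `≲ log(ρ/η) (η/ρ)^β` by the junction two-strand decay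
(`ufrs_junctionBranch_le`, `…UFRSJunctionBranchDecay.lean`). This file names

* `ufrsJunction E w η ρ` — the junction event (the set of configurations with the two-scale
  junction data at some collar point of `E.Ω`), with `mem_ufrsJunction_iff` (`Iff.rfl`);
* `ufrsResidualSlippedReturnJ`, `ufrsResidualInitialContactJ` — the J-FORMS of the residual
  sub-goals `ufrs_slippedReturnCase_cert`, `ufrs_initialContactCase_cert` (verbatim the registered
  sub-goals `ufrs_slippedReturnCase_certJ`, `ufrs_initialContactCase_certJ`): same data, weaker
  conclusion `∃ z ∈ D, infDist z Dᶜ < 3η ∧ (ω ∈ ufrsCert E w z (4η) (ρ/2) ∨ junction data at z)`,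
  with their unfoldings `…_iff` (`Iff.rfl`) and the trivial bridges `…J_of` from the original forms.

The J-form arm domination `ufrs_armDominationJ_of_residuals` (`…UFRSArmDominationJ.lean`), the glue
`ufrs_of_piecesJ` (`…UFRSPiecesJ.lean`, the junction event is the `B`-event of
`ufrs_of_screenedArmDomination`) and the rectangle assembly `ufrs_rect_of_leavesJ`
(`…UFRSRectOfLeaves.lean`) are stated with these names.

References: S. Smirnov, C. R. Acad. Sci. Paris 333 (2001), §2; P. Nolin, Electron. J. Probab. 13
(2008), §4 (arm events near boundary points); G. F. Lawler, O. Schramm, W. Werner, Electron. J.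
Probab. 7 (2002), App. A.
-/

namespace Summit.CriticalPhenomena.CardyFormulaZ2.Cruxes.EdgePrecompact.QkzStripBoundaryArm

open MeasureTheory Filter Set Metric
open scoped Topology BigOperators Pointwise
open Literature.Probability.LatticeModels Literature.Probability.Percolation
open Literature.Probability.RandomPlanarGeometry (DobrushinDomain)
open Summit.CriticalPhenomena.CardyFormulaZ2.Theses.CardyComplexCone

noncomputable section

/-- **The junction event** of the datum `E`, shift `w`, collar scale `η`, ball radius `ρ`: some
point `z ∈ E.Ω` of the `3η`-collar of `E.Ω` has a marked edge (of `E` or of `shiftData E w`)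
within `4η`, a dyadic radius `R' = ρ/4/2^(k+1)` with `32 · 4η ≤ R'`, two strand-crossings of the
annulus `A(z; 4η, R')` and two strand-crossings of `A(z; 4R', ρ/4)` (the event bounded by
`ufrs_junctionBranch_le` with `Ω := E.Ω`). -/
def ufrsJunction (E : DiscreteDobrushin) (w : Site 2) (η ρ : ℝ) : Set (BondConfig (Site 2)) :=
  {ω | ∃ z ∈ E.Ω, infDist z E.Ωᶜ < 3 * η ∧ z ∈ ufrsMarkedNbhd E w (4 * η) ∧ ∃ R' : ℝ, (∃ k : ℕ, R' = ρ / 2 / 2 / 2 ^ (k + 1)) ∧ 32 * (4 * η) ≤ R' ∧ ω ∈ ufrsStrands E w z 2 (4 * η) R' ∧ ω ∈ ufrsStrands E w z 2 (4 * R') (ρ / 2 / 2)}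

/-- Unfolding of `ufrsJunction` (by `Iff.rfl`). -/
theorem mem_ufrsJunction_iff : ∀ (E : DiscreteDobrushin) (w : Site 2) (η ρ : ℝ) (ω : BondConfig (Site 2)), ω ∈ ufrsJunction E w η ρ ↔ ∃ z ∈ E.Ω, infDist z E.Ωᶜ < 3 * η ∧ z ∈ ufrsMarkedNbhd E w (4 * η) ∧ ∃ R' : ℝ, (∃ k : ℕ, R' = ρ / 2 / 2 / 2 ^ (k + 1)) ∧ 32 * (4 * η) ≤ R' ∧ ω ∈ ufrsStrands E w z 2 (4 * η) R' ∧ ω ∈ ufrsStrands E w z 2 (4 * R') (ρ / 2 / 2) :=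
  fun _ _ _ _ _ => Iff.rfl

/-- The junction event is, as a set, the set-builder of its defining property (by `rfl`); this is
the form in which it appears in `ufrs_junctionBranch_le` (with `Ω := E.Ω`) and in the registered
sub-goal `ufrs_junctionDecay_rect_of_HJ`. -/
theorem ufrsJunction_eq : ∀ (E : DiscreteDobrushin) (w : Site 2) (η ρ : ℝ), ufrsJunction E w η ρ = {ω : BondConfig (Site 2) | ∃ z ∈ E.Ω, infDist z E.Ωᶜ < 3 * η ∧ z ∈ ufrsMarkedNbhd E w (4 * η) ∧ ∃ R' : ℝ, (∃ k : ℕ, R' = ρ / 2 / 2 / 2 ^ (k + 1)) ∧ 32 * (4 * η) ≤ R' ∧ ω ∈ ufrsStrands E w z 2 (4 * η) R' ∧ ω ∈ ufrsStrands E w z 2 (4 * R') (ρ / 2 / 2)} :=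
  fun _ _ _ _ => rfl

/-- **Residual configuration (B), "slipped return", J-form** (verbatim the registered sub-goal
`ufrs_slippedReturnCase_certJ`): the data of `ufrsResidualSlippedReturn` (SPLIT branch of
`ufrs_failureStructure`, the run of the second dynamics from the split corner ends AT the re-entry
corner `O₀ a n` of the first stretch by entering the ball); to show: at a collar point `z ∈ D`,
the certificate `ufrsCert E w z (4η) (ρ/2)` OR the two-scale junction data. -/
def ufrsResidualSlippedReturnJ : Prop :=
  ∀ (D : DobrushinDomain) (η : ℝ), 0 < η → ∃ δ₀ > (0:ℝ), ∀ E : DiscreteDobrushin, E.Ω = D.carrier → E.IsZdAdmissible → E.δ < δ₀ → ∀ (v w : Site 2) (ρ : ℝ), 4 * η ≤ ρ → 2 * ρ ≤ infDist (meshPoint E.δ v) D.carrierᶜ → ‖meshPoint E.δ w‖ < η → ∀ (ω : BondConfig (Site 2)) (a a' : Site 2 × Fin 4) (n m k T : ℕ), ((E.IsStartCorner a ∧ (shiftData E w).IsStartCorner a') ∨ (a = a' ∧ medialPoint E.δ (cSrc a) ∈ ball (meshPoint E.δ v) ρ ∧ medialPoint E.δ (cTgt a) ∉ ball (meshPoint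 E.δ v) ρ)) → (∀ i < n, medialPoint E.δ (cTgt (cornerOrbit (E.bcBondConfig ω) a i)) ∉ ball (meshPoint E.δ v) ρ ∧ E.IsInnerFace (cFace (cornerOrbit (E.bcBondConfig ω) a (i + 1)))) → medialPoint E.δ (cTgt (cornerOrbit (E.bcBondConfig ω) a n)) ∈ ball (meshPoint E.δ v) ρ → m < n → (∀ i < k, medialPoint E.δ (cTgt (cornerOrbit ((shiftData E w).bcBondConfig ω) a' i)) ∉ ball (meshPoint E.δ v) ρ ∧ (shiftData E w).IsInnerFace (cFace (cornerOrbit ((shiftData E w).bcBondConfig ω) a' (i + 1)))) → cornerOrbit ((shiftData E w).bcBondConfig ω) a' k = cornerOrbit (E.bcBondConfig ω) a m → ∑ i ∈ Finset.range k, turnOf ((shiftData E w).bcBondConfig ω) (cornerOrbit ((shiftData E w).bcBondConfig ω) a' i) = ∑ i ∈ Finset.range m, turnOf (E.bcBondConfig ω) (cornerOrbit (E.bcBondConfig ω) a i) → infDist (meshPoint E.δ (cornerOrbit (E.bcBondConfig ω) a m).1) D.carrierᶜ < 3 * η → ¬ (cTgt (cornerOrbit (E.bcBondConfig ω) a m)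 ∈ E.bcBondConfig ω ↔ cTgt (cornerOrbit (E.bcBondConfig ω) a m) ∈ (shiftData E w).bcBondConfig ω) → (∀ j j₀ : ℕ, m < j₀ → j₀ ≤ n → (∀ i < j, medialPoint E.δ (cTgt (cornerOrbit ((shiftData E w).bcBondConfig ω) (cornerOrbit (E.bcBondConfig ω) a m) i)) ∉ ball (meshPoint E.δ v) ρ ∧ (shiftData E w).IsInnerFace (cFace (cornerOrbit ((shiftData E w).bcBondConfig ω) (cornerOrbit (E.bcBondConfig ω) a m) (i + 1)))) → cornerOrbit ((shiftData E w).bcBondConfig ω) (cornerOrbit (E.bcBondConfig ω) a m) j = cornerOrbit (E.bcBondConfig ω) a j₀ → ∑ i ∈ Finset.range j, turnOf ((shiftData E w).bcBondConfig ω) (cornerOrbit ((shiftData E w).bcBondConfig ω) (cornerOrbit (E.bcBondConfig ω) a m) i) ≠ ∑ i ∈ Finset.Ico m j₀, turnOf (E.bcBondConfig ω) (cornerOrbit (E.bcBondConfig ω) a i)) → (∀ i < T, medialPoint E.δ (cTgt (cornerOrbit ((shiftData E w).bcBondConfig ω) (cornerOrbit (E.bcBondConfig ω) a m) i)) ∉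 ball (meshPoint E.δ v) ρ ∧ (shiftData E w).IsInnerFace (cFace (cornerOrbit ((shiftData E w).bcBondConfig ω) (cornerOrbit (E.bcBondConfig ω) a m) (i + 1)))) → (medialPoint E.δ (cTgt (cornerOrbit ((shiftData E w).bcBondConfig ω) (cornerOrbit (E.bcBondConfig ω) a m) T)) ∈ ball (meshPoint E.δ v) ρ ∨ ¬ (shiftData E w).IsInnerFace (cFace (cornerOrbit ((shiftData E w).bcBondConfig ω) (cornerOrbit (E.bcBondConfig ω) a m) (T + 1)))) → cornerOrbit ((shiftData E w).bcBondConfig ω) (cornerOrbit (E.bcBondConfig ω) a m) T = cornerOrbit (E.bcBondConfig ω) a n → medialPoint E.δ (cTgt (cornerOrbit ((shiftData E w).bcBondConfig ω) (cornerOrbit (E.bcBondConfig ω) a m) T)) ∈ ball (meshPoint E.δ v) ρ → ∃ z ∈ D.carrier, infDist z D.carrierᶜ < 3 * η ∧ (ω ∈ ufrsCert E w z (4 * η) (ρ / 2) ∨ (z ∈ ufrsMarkedNbhd E w (4 * η) ∧ ∃ R' : ℝ, (∃ k : ℕ, R' = ρ / 2 / 2 / 2 ^ (k + 1)) ∧ 32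 * (4 * η) ≤ R' ∧ ω ∈ ufrsStrands E w z 2 (4 * η) R' ∧ ω ∈ ufrsStrands E w z 2 (4 * R') (ρ / 2 / 2)))

/-- **Residual INITIAL configuration with a contact, J-form** (verbatim the registered sub-goal
`ufrs_initialContactCase_certJ`): the data of `ufrsResidualInitialContact` (INITIAL branch, the
two start strands meet first at `O₁ a' j = O₀ a i` with turning offset `2πℓ`, `ℓ ≠ 0`); to show:
at a collar point `z ∈ D`, the certificate OR the two-scale junction data. -/
def ufrsResidualInitialContactJ : Prop :=
  ∀ (D : DobrushinDomain) (η : ℝ), 0 < η → ∃ δ₀ > (0:ℝ), ∀ E : DiscreteDobrushin, E.Ω = D.carrier → E.IsZdAdmissible → E.δ < δ₀ → ∀ (v w : Site 2) (ρ : ℝ), 4 * η ≤ ρ → 2 * ρ ≤ infDist (meshPoint E.δ v) D.carrierᶜ → ‖meshPoint E.δ w‖ < η → ∀ (ω : BondConfig (Site 2)) (a a' : Site 2 × Fin 4) (n T j i : ℕ) (ℓ : ℤ), E.IsStartCorner a → (shiftData E w).IsStartCorner a' → (∀ i < n, medialPoint E.δ (cTgt (cornerOrbit (E.bcBondConfig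 ω) a i)) ∉ ball (meshPoint E.δ v) ρ ∧ E.IsInnerFace (cFace (cornerOrbit (E.bcBondConfig ω) a (i + 1)))) → medialPoint E.δ (cTgt (cornerOrbit (E.bcBondConfig ω) a n)) ∈ ball (meshPoint E.δ v) ρ → (∀ m k : ℕ, m ≤ n → (∀ i < k, medialPoint E.δ (cTgt (cornerOrbit ((shiftData E w).bcBondConfig ω) a' i)) ∉ ball (meshPoint E.δ v) ρ ∧ (shiftData E w).IsInnerFace (cFace (cornerOrbit ((shiftData E w).bcBondConfig ω) a' (i + 1)))) → cornerOrbit ((shiftData E w).bcBondConfig ω) a' k = cornerOrbit (E.bcBondConfig ω) a m → ∑ i ∈ Finset.range k, turnOf ((shiftData E w).bcBondConfig ω) (cornerOrbit ((shiftData E w).bcBondConfig ω) a' i) ≠ ∑ i ∈ Finset.range m, turnOf (E.bcBondConfig ω) (cornerOrbit (E.bcBondConfig ω) a i)) → (∀ i < T, medialPoint E.δ (cTgt (cornerOrbit ((shiftData E w).bcBondConfig ω) a' i)) ∉ ball (meshPoint E.δ v) ρ ∧ (shiftData E w).IsInnerFace (cFace (cornerOrbit ((shiftData E w).bcBondConfig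 ω) a' (i + 1)))) → (medialPoint E.δ (cTgt (cornerOrbit ((shiftData E w).bcBondConfig ω) a' T)) ∈ ball (meshPoint E.δ v) ρ ∨ ¬ (shiftData E w).IsInnerFace (cFace (cornerOrbit ((shiftData E w).bcBondConfig ω) a' (T + 1)))) → j ≤ T → i ≤ n → cornerOrbit ((shiftData E w).bcBondConfig ω) a' j = cornerOrbit (E.bcBondConfig ω) a i → (∀ j' < j, ∀ i' ≤ n, cornerOrbit ((shiftData E w).bcBondConfig ω) a' j' ≠ cornerOrbit (E.bcBondConfig ω) a i') → ℓ ≠ 0 → ∑ t ∈ Finset.range i, turnOf (E.bcBondConfig ω) (cornerOrbit (E.bcBondConfig ω) a t) - ∑ t ∈ Finset.range j, turnOf ((shiftData E w).bcBondConfig ω) (cornerOrbit ((shiftData E w).bcBondConfig ω) a' t) = 2 * Real.pi * ℓ → ∃ z ∈ D.carrier, infDist z D.carrierᶜ < 3 * η ∧ (ω ∈ ufrsCert E w z (4 * η) (ρ / 2) ∨ (z ∈ ufrsMarkedNbhd E w (4 * η) ∧ ∃ R' : ℝ, (∃ k : ℕ, R' = ρ / 2 / 2 / 2 ^ (k + 1))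 ∧ 32 * (4 * η) ≤ R' ∧ ω ∈ ufrsStrands E w z 2 (4 * η) R' ∧ ω ∈ ufrsStrands E w z 2 (4 * R') (ρ / 2 / 2)))

/-! ## Unfolding (by `Iff.rfl`) and the bridges from the original forms -/

/-- Unfolding of `ufrsResidualSlippedReturnJ` (by `Iff.rfl`). -/
theorem ufrsResidualSlippedReturnJ_iff : ufrsResidualSlippedReturnJ ↔ (∀ (D : DobrushinDomain) (η : ℝ), 0 < η → ∃ δ₀ > (0:ℝ), ∀ E : DiscreteDobrushin, E.Ω = D.carrier → E.IsZdAdmissible → E.δ < δ₀ → ∀ (v w : Site 2) (ρ : ℝ), 4 * η ≤ ρ → 2 * ρ ≤ infDist (meshPoint E.δ v) D.carrierᶜ → ‖meshPoint E.δ w‖ < η → ∀ (ω : BondConfig (Site 2)) (a a' : Site 2 × Fin 4) (n m k T : ℕ), ((E.IsStartCorner a ∧ (shiftData E w).IsStartCorner a') ∨ (a = a' ∧ medialPoint E.δ (cSrc a) ∈ ball (meshPoint E.δ v) ρ ∧ medialPoint E.δ (cTgt a) ∉ ball (meshPoint E.δ v) ρ)) → (∀ i < n, medialPoint E.δ (cTgt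 (cornerOrbit (E.bcBondConfig ω) a i)) ∉ ball (meshPoint E.δ v) ρ ∧ E.IsInnerFace (cFace (cornerOrbit (E.bcBondConfig ω) a (i + 1)))) → medialPoint E.δ (cTgt (cornerOrbit (E.bcBondConfig ω) a n)) ∈ ball (meshPoint E.δ v) ρ → m < n → (∀ i < k, medialPoint E.δ (cTgt (cornerOrbit ((shiftData E w).bcBondConfig ω) a' i)) ∉ ball (meshPoint E.δ v) ρ ∧ (shiftData E w).IsInnerFace (cFace (cornerOrbit ((shiftData E w).bcBondConfig ω) a' (i + 1)))) → cornerOrbit ((shiftData E w).bcBondConfig ω) a' k = cornerOrbit (E.bcBondConfig ω) a m → ∑ i ∈ Finset.range k, turnOf ((shiftData E w).bcBondConfig ω) (cornerOrbit ((shiftData E w).bcBondConfig ω) a' i) = ∑ i ∈ Finset.range m, turnOf (E.bcBondConfig ω) (cornerOrbit (E.bcBondConfig ω) a i) → infDist (meshPoint E.δ (cornerOrbit (E.bcBondConfig ω) a m).1) D.carrierᶜ < 3 * η → ¬ (cTgt (cornerOrbit (E.bcBondConfig ω) a m) ∈ E.bcBondConfig ω ↔ cTgt (cornerOrbit (E.bcBondConfig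 ω) a m) ∈ (shiftData E w).bcBondConfig ω) → (∀ j j₀ : ℕ, m < j₀ → j₀ ≤ n → (∀ i < j, medialPoint E.δ (cTgt (cornerOrbit ((shiftData E w).bcBondConfig ω) (cornerOrbit (E.bcBondConfig ω) a m) i)) ∉ ball (meshPoint E.δ v) ρ ∧ (shiftData E w).IsInnerFace (cFace (cornerOrbit ((shiftData E w).bcBondConfig ω) (cornerOrbit (E.bcBondConfig ω) a m) (i + 1)))) → cornerOrbit ((shiftData E w).bcBondConfig ω) (cornerOrbit (E.bcBondConfig ω) a m) j = cornerOrbit (E.bcBondConfig ω) a j₀ → ∑ i ∈ Finset.range j, turnOf ((shiftData E w).bcBondConfig ω) (cornerOrbit ((shiftData E w).bcBondConfig ω) (cornerOrbit (E.bcBondConfig ω) a m) i) ≠ ∑ i ∈ Finset.Ico m j₀, turnOf (E.bcBondConfig ω) (cornerOrbit (E.bcBondConfig ω) a i)) → (∀ i < T, medialPoint E.δ (cTgt (cornerOrbit ((shiftData E w).bcBondConfig ω) (cornerOrbit (E.bcBondConfig ω) a m) i)) ∉ ball (meshPoint E.δ v) ρ ∧ (shiftData E w).IsInnerFace (cFace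 (cornerOrbit ((shiftData E w).bcBondConfig ω) (cornerOrbit (E.bcBondConfig ω) a m) (i + 1)))) → (medialPoint E.δ (cTgt (cornerOrbit ((shiftData E w).bcBondConfig ω) (cornerOrbit (E.bcBondConfig ω) a m) T)) ∈ ball (meshPoint E.δ v) ρ ∨ ¬ (shiftData E w).IsInnerFace (cFace (cornerOrbit ((shiftData E w).bcBondConfig ω) (cornerOrbit (E.bcBondConfig ω) a m) (T + 1)))) → cornerOrbit ((shiftData E w).bcBondConfig ω) (cornerOrbit (E.bcBondConfig ω) a m) T = cornerOrbit (E.bcBondConfig ω) a n → medialPoint E.δ (cTgt (cornerOrbit ((shiftData E w).bcBondConfig ω) (cornerOrbit (E.bcBondConfig ω) a m) T)) ∈ ball (meshPoint E.δ v) ρ → ∃ z ∈ D.carrier, infDist z D.carrierᶜ < 3 * η ∧ (ω ∈ ufrsCert E w z (4 * η) (ρ / 2) ∨ (z ∈ ufrsMarkedNbhd E w (4 * η) ∧ ∃ R' : ℝ, (∃ k : ℕ, R' = ρ / 2 / 2 / 2 ^ (k + 1)) ∧ 32 * (4 * η) ≤ R' ∧ ω ∈ ufrsStrands E w z 2 (4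 * η) R' ∧ ω ∈ ufrsStrands E w z 2 (4 * R') (ρ / 2 / 2)))) :=
  Iff.rfl

/-- Unfolding of `ufrsResidualInitialContactJ` (by `Iff.rfl`). -/
theorem ufrsResidualInitialContactJ_iff : ufrsResidualInitialContactJ ↔ (∀ (D : DobrushinDomain) (η : ℝ), 0 < η → ∃ δ₀ > (0:ℝ), ∀ E : DiscreteDobrushin, E.Ω = D.carrier → E.IsZdAdmissible → E.δ < δ₀ → ∀ (v w : Site 2) (ρ : ℝ), 4 * η ≤ ρ → 2 * ρ ≤ infDist (meshPoint E.δ v) D.carrierᶜ → ‖meshPoint E.δ w‖ < η → ∀ (ω : BondConfig (Site 2)) (a a' : Site 2 × Fin 4) (n T j i : ℕ) (ℓ : ℤ), E.IsStartCorner a → (shiftData E w).IsStartCorner a' → (∀ i < n, medialPoint E.δ (cTgt (cornerOrbit (E.bcBondConfig ω) a i)) ∉ ball (meshPoint E.δ v) ρ ∧ E.IsInnerFace (cFace (cornerOrbit (E.bcBondConfig ω) a (i + 1)))) → medialPoint E.δ (cTgt (cornerOrbit (E.bcBondConfig ω) a n)) ∈ ball (meshPoint E.δ v) ρ → (∀ m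 k : ℕ, m ≤ n → (∀ i < k, medialPoint E.δ (cTgt (cornerOrbit ((shiftData E w).bcBondConfig ω) a' i)) ∉ ball (meshPoint E.δ v) ρ ∧ (shiftData E w).IsInnerFace (cFace (cornerOrbit ((shiftData E w).bcBondConfig ω) a' (i + 1)))) → cornerOrbit ((shiftData E w).bcBondConfig ω) a' k = cornerOrbit (E.bcBondConfig ω) a m → ∑ i ∈ Finset.range k, turnOf ((shiftData E w).bcBondConfig ω) (cornerOrbit ((shiftData E w).bcBondConfig ω) a' i) ≠ ∑ i ∈ Finset.range m, turnOf (E.bcBondConfig ω) (cornerOrbit (E.bcBondConfig ω) a i)) → (∀ i < T, medialPoint E.δ (cTgt (cornerOrbit ((shiftData E w).bcBondConfig ω) a' i)) ∉ ball (meshPoint E.δ v) ρ ∧ (shiftData E w).IsInnerFace (cFace (cornerOrbit ((shiftData E w).bcBondConfig ω) a' (i + 1)))) → (medialPoint E.δ (cTgt (cornerOrbit ((shiftData E w).bcBondConfig ω) a' T)) ∈ ball (meshPoint E.δ v) ρ ∨ ¬ (shiftData E w).IsInnerFace (cFace (cornerOrbit ((shiftData E w).bcBondConfig ω) a' (T +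 1)))) → j ≤ T → i ≤ n → cornerOrbit ((shiftData E w).bcBondConfig ω) a' j = cornerOrbit (E.bcBondConfig ω) a i → (∀ j' < j, ∀ i' ≤ n, cornerOrbit ((shiftData E w).bcBondConfig ω) a' j' ≠ cornerOrbit (E.bcBondConfig ω) a i') → ℓ ≠ 0 → ∑ t ∈ Finset.range i, turnOf (E.bcBondConfig ω) (cornerOrbit (E.bcBondConfig ω) a t) - ∑ t ∈ Finset.range j, turnOf ((shiftData E w).bcBondConfig ω) (cornerOrbit ((shiftData E w).bcBondConfig ω) a' t) = 2 * Real.pi * ℓ → ∃ z ∈ D.carrier, infDist z D.carrierᶜ < 3 * η ∧ (ω ∈ ufrsCert E w z (4 * η) (ρ / 2) ∨ (z ∈ ufrsMarkedNbhd E w (4 * η) ∧ ∃ R' : ℝ, (∃ k : ℕ, R' = ρ / 2 / 2 / 2 ^ (k + 1)) ∧ 32 * (4 * η) ≤ R' ∧ ω ∈ ufrsStrands E w z 2 (4 * η) R' ∧ ω ∈ ufrsStrands E w z 2 (4 * R') (ρ / 2 / 2)))) :=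
  Iff.rfl

/-- The original residual `ufrsResidualSlippedReturn` implies its J-form (`Or.inl`). -/
theorem ufrsResidualSlippedReturnJ_of : ufrsResidualSlippedReturn → ufrsResidualSlippedReturnJ := by
  intro h D η hη
  obtain ⟨δ₀, hδ₀, h⟩ := h D η hη
  refine ⟨δ₀, hδ₀, ?_⟩
  intro E hEΩ hE hEδ v w ρ hηρ hv hw ω a a' n m k T h₁ h₂ h₃ h₄ h₅ h₆ h₇ h₈ h₉ h₁₀ h₁₁ h₁₂ h₁₃ h₁₄
  obtain ⟨z, hz, hzc, hc⟩ := h E hEΩ hE hEδ v w ρ hηρ hv hw ω a a' n m k T h₁ h₂ h₃ h₄ h₅ h₆ h₇ h₈ h₉ h₁₀ h₁₁ h₁₂ h₁₃ h₁₄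
  exact ⟨z, hz, hzc, Or.inl hc⟩

/-- The original residual `ufrsResidualInitialContact` implies its J-form (`Or.inl`). -/
theorem ufrsResidualInitialContactJ_of : ufrsResidualInitialContact → ufrsResidualInitialContactJ := by
  intro h D η hη
  obtain ⟨δ₀, hδ₀, h⟩ := h D η hη
  refine ⟨δ₀, hδ₀, ?_⟩
  intro E hEΩ hE hEδ v w ρ hηρ hv hw ω a a' n T j i ℓ h₁ h₂ h₃ h₄ h₅ h₆ h₇ h₈ h₉ h₁₀ h₁₁ h₁₂ h₁₃
  obtain ⟨z, hz, hzc, hc⟩ := h E hEΩ hE hEδ v w ρ hηρ hv hw ω a a' n T j i ℓ h₁ h₂ h₃ h₄ h₅ h₆ h₇ h₈ h₉ h₁₀ h₁₁ h₁₂ h₁₃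
  exact ⟨z, hz, hzc, Or.inl hc⟩

end

end Summit.CriticalPhenomena.CardyFormulaZ2.Cruxes.EdgePrecompact.QkzStripBoundaryArm
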